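import Summits.ResolutionOfSingularities.KangarooAtlas.MizutaniTowerModel
import Literature.AlgebraicGeometry.Resolution.HasseSchmidtDiffEqDiffOp
import Mathlib.Data.Nat.Choose.Lucas
import Mathlib.Algebra.CharP.Basic
import Mathlib.Algebra.CharP.Lemmas
import Mathlib.LinearAlgebra.Basis.Basic
import HarnessLib

/-!
# Mizutani's conjecture `m(e) = 2p^e − 1` — towers with an arbitrary (possibly infinite) `p`-basis

Cell topic `Summits/ResolutionOfSingularities/KangarooAtlas` (pub-rosobs); namespace
`Summit.ResolutionOfSingularities.KangarooAtlas.Mizutani`.  Part of the Lean transcription of the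
in-house note MIZUTANI-PROOF-g59 (AI-written, AI-audited; *AI review is weaker than expert review*; not a
resolution theorem).  This file starts the §3 DICTIONARY (Oda 1983-II p. 1168: the invariant additive forms
`(L_B)_e` of a Hironaka subgroup scheme are cut out by the differential operators of `k` over `k^{p^e}`):
to read those operators we need the Hasse–Schmidt operators of `k` over `L = k^{p^e}` attached to a
`p`-BASIS of `k`, which may be infinite.  So here, for a field `k ⊇ L` and a family `a : ι → k` (any index
type `ι`) with `a_i^q = x_i ∈ L` whose box monomials `a^W` (`W : ι →₀ ℕ`, all `W_i < q`) form an `L`-basis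
of `k` (`IsPTower L k q x a` — for `ι = Fin s` this is the tower of `MizutaniRootTower`, §1.1 of the note):

* `pmon a W = a^W`, `IsPTower.basis`;
* the **Hasse–Schmidt operators** `IsPTower.hsD T : k →ₗ[L] k`, `a^W ↦ C(W,T) a^{W−T}` (defined on the
  basis), and `IsPTower.hsD_aeval`: `hsD_T (f(a)) = (D^{(T)} f)(a)` for every polynomial `f ∈ L[X_ι]` and every
  `T` in the box — so the operators are the images of the Hasse–Schmidt derivatives of the polynomial ring
  (EGA IV 16.11.2), through the Lucas congruence `C(N,T) ≡ C(N mod q, T)` (`choose_modEq_choose_mod_pow`);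
* consequences: `hsD_zero` (`D^{(0)} = id`), `hsD_pmon` (`D^{(T)} a^N = C(N,T) a^{N−T}` for ALL `N`),
  `hsD_mul` (Leibniz), `hsD_hsD` (iterativity `D^{(T₁)} D^{(T₂)} = C(T₁+T₂,T₁) D^{(T₁+T₂)}`).

References: [Mizutani1973HironakaGroupSchemes] (Remark 2.10; in-house proof §1.1, §1.4);
[Oda1983HironakaGroupSchemeII] §1 (p. 1166: a `p`-basis of `k`, the operators `∂_λ`); [EGAIV4] Thm. 16.11.2;
[Matsumura1986] §26 (p-bases).
-/

open MvPolynomial Literature.AlgebraicGeometry.Resolution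

namespace Summit.ResolutionOfSingularities.KangarooAtlas.Mizutani

/-! ## Lucas modulo a prime power -/

section Lucas

variable {p : ℕ} [hp : Fact p.Prime]

/-- **Lucas, prime-power form**: `C(n, t) ≡ C(n mod p^e, t) (mod p)` for `t < p^e` (the base-`p` digits of `t`
above position `e` vanish). [folklore] -/
theorem choose_modEq_choose_mod_pow : ∀ (e : ℕ) {t : ℕ} (_ : t < p ^ e) (n : ℕ),
    n.choose t ≡ (n % p ^ e).choose t [MOD p]
  | 0, t, ht, n => by
    have : t = 0 := by simpa using ht
    subst this
    simp [Nat.ModEq.refl]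
  | e + 1, t, ht, n => by
    have h1 := Choose.choose_modEq_choose_mod_mul_choose_div_nat (n := n) (k := t) (p := p)
    have h2 := Choose.choose_modEq_choose_mod_mul_choose_div_nat (n := n % p ^ (e + 1)) (k := t) (p := p)
    have hpos : 0 < p := hp.out.pos
    have ht' : t / p < p ^ e := by
      rw [Nat.div_lt_iff_lt_mul hpos, ← pow_succ]; exact ht
    have ih := choose_modEq_choose_mod_pow e ht' (n / p)
    have hmod : n % p ^ (e + 1) % p = n % p := Nat.mod_mod_of_dvd n (dvd_pow_self p (Nat.succ_ne_zero e))
    have hdiv : n % p ^ (e + 1) / p = n / p % p ^ e := by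
      rw [pow_succ', Nat.mod_mul_right_div_self]
    rw [hmod, hdiv] at h2
    exact h1.trans ((Nat.ModEq.mul_left _ ih).trans h2.symm)

/-- In characteristic `p`: `C(n, t) = C(n mod p^e, t)` as elements of `k`, for `t < p^e`. [folklore] -/
theorem natCast_choose_eq_choose_mod_pow (k : Type*) [Ring k] [CharP k p] (e : ℕ) {t : ℕ} (ht : t < p ^ e)
    (n : ℕ) : ((n.choose t : ℕ) : k) = (((n % p ^ e).choose t : ℕ) : k) :=
  CharP.natCast_eq_natCast' k p (choose_modEq_choose_mod_pow e ht n)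

end Lucas

/-! ## Box monomials and towers over an arbitrary index type -/

section PTower

variable {ι : Type*} {L k : Type*} [Field L] [Field k] [Algebra L k]

/-- The monomial `a^W = ∏_{i ∈ supp W} a_i^{W_i}` of a family `a : ι → k`. [folklore] -/
noncomputable def pmon (a : ι → k) (W : ι →₀ ℕ) : k := W.prod fun i n => a i ^ n

omit [Algebra L k] in
/-- `a^0 = 1`. [folklore] -/
@[simp] theorem pmon_zero (a : ι → k) : pmon a 0 = 1 := by
  simp [pmon]

omit [Algebra L k] in
/-- `a^{V+W} = a^V a^W`. [folklore] -/
theorem pmon_add (a : ι → k) (V W : ι →₀ ℕ) : pmon a (V + W) = pmon a V * pmon a W :=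
  Finsupp.prod_add_index' (fun _ => pow_zero _) fun _ _ _ => pow_add _ _ _

omit [Algebra L k] in
/-- `a^{n • W} = (a^W)^n`. [folklore] -/
theorem pmon_nsmul (a : ι → k) (n : ℕ) (W : ι →₀ ℕ) : pmon a (n • W) = pmon a W ^ n := by
  induction n with
  | zero => simp
  | succ n ih => rw [succ_nsmul, pmon_add, ih, pow_succ]

/-- `f(a)` of a monomial: `(c X^W)(a) = c · a^W`. [folklore] -/
theorem aeval_monomial_eq_smul_pmon (a : ι → k) (W : ι →₀ ℕ) (c : L) :
    aeval a (monomial W c) = c • pmon a W := by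
  rw [aeval_monomial, Algebra.smul_def]
  rfl

/-- The box index set `{W : ι →₀ ℕ // W_i < q for all i}` (the exponents of the `L`-basis `a^W`).
[cite: Oda1983HironakaGroupSchemeII, §1 (p. 1166: the monomials a^λ, λ in the box, form a k-basis of F^{-e}(k))] -/
def BoxIdx (ι : Type*) (q : ℕ) : Type _ := {W : ι →₀ ℕ // InBox q W}

variable (L k) in
/-- **A tower with `p`-basis `a`** (possibly infinite): `a_i^q = x_i ∈ L` and the box monomials `a^W`,
`W_i < q`, form an `L`-basis of `k` (MIZUTANI-PROOF-g59 §1.1 for finitely many `a_i`; Oda 1983-II §1 p. 1166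
for a `p`-basis `{a_γ}` of `k` over `F(k)`: "the monomials … form an `F(k)`-linear basis of `k`").
[cite: Oda1983HironakaGroupSchemeII, §1 (p. 1166)] -/
structure IsPTower (q : ℕ) (x : ι → L) (a : ι → k) : Prop where
  /-- `a_i^q = x_i ∈ L` -/
  pow_eq : ∀ i, a i ^ q = algebraMap L k (x i)
  /-- the box monomials are `L`-linearly independent -/
  linearIndependent : LinearIndependent L fun W : BoxIdx ι q => pmon a W.1
  /-- the box monomials span `k` over `L` -/
  span_eq_top : Submodule.span L (Set.range fun W : BoxIdx ι q => pmon a W.1) = ⊤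

variable {q : ℕ} {x : ι → L} {a : ι → k}

/-- The `L`-basis of box monomials of a tower. [cite: Oda1983HironakaGroupSchemeII, §1 (p. 1166)] -/
noncomputable def IsPTower.basis (h : IsPTower L k q x a) : Module.Basis (BoxIdx ι q) L k :=
  Module.Basis.mk h.linearIndependent (by rw [h.span_eq_top])

/-- The basis vectors are the box monomials. [folklore] -/
@[simp] theorem IsPTower.basis_apply (h : IsPTower L k q x a) (W : BoxIdx ι q) : h.basis W = pmon a W.1 := by
  unfold IsPTower.basis; rw [Module.Basis.mk_apply]

/-- `a^{q • V} = x^V ∈ L`. [folklore] -/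
theorem IsPTower.pmon_nsmul_eq (h : IsPTower L k q x a) (V : ι →₀ ℕ) :
    pmon a (q • V) = algebraMap L k (V.prod fun i n => x i ^ n) := by
  rw [pmon_nsmul, pmon, Finsupp.prod, Finsupp.prod, ← Finset.prod_pow, map_prod]
  refine Finset.prod_congr rfl fun i _ => ?_
  rw [← pow_mul, mul_comm, pow_mul, h.pow_eq, map_pow]

/-! ### Reduction of exponents modulo `q` -/

/-- The componentwise remainder `W mod q`. [folklore] -/
noncomputable def modPart (q : ℕ) (N : ι →₀ ℕ) : ι →₀ ℕ := N.mapRange (· % q) (Nat.zero_mod q)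

/-- The componentwise quotient `⌊W / q⌋`. [folklore] -/
noncomputable def divPart (q : ℕ) (N : ι →₀ ℕ) : ι →₀ ℕ := N.mapRange (· / q) (Nat.zero_div q)

omit [Field L] [Field k] [Algebra L k] in
/-- `(N mod q)_i = N_i mod q`. [folklore] -/
@[simp] theorem modPart_apply (q : ℕ) (N : ι →₀ ℕ) (i : ι) : modPart q N i = N i % q := by
  simp [modPart]

omit [Field L] [Field k] [Algebra L k] in
/-- `⌊N/q⌋_i = N_i / q`. [folklore] -/
@[simp] theorem divPart_apply (q : ℕ) (N : ι →₀ ℕ) (i : ι) : divPart q N i = N i / q := by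
  simp [divPart]

omit [Field L] [Field k] [Algebra L k] in
/-- `N = q • ⌊N/q⌋ + (N mod q)`. [folklore] -/
theorem nsmul_divPart_add_modPart (q : ℕ) (N : ι →₀ ℕ) : q • divPart q N + modPart q N = N := by
  ext i
  simp only [Finsupp.coe_add, Finsupp.coe_smul, Pi.add_apply, Pi.smul_apply, divPart_apply, modPart_apply,
    smul_eq_mul]
  exact Nat.div_add_mod (N i) q

omit [Field L] [Field k] [Algebra L k] in
/-- `N mod q` lies in the box (for `q ≥ 1`). [folklore] -/
theorem inBox_modPart {q : ℕ} (hq : 0 < q) (N : ι →₀ ℕ) : InBox q (modPart q N) := fun i => by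
  rw [modPart_apply]; exact Nat.mod_lt _ hq

/-- **Reduction**: `a^N = x^{⌊N/q⌋} · a^{N mod q}`. [folklore] -/
theorem IsPTower.pmon_eq (h : IsPTower L k q x a) (N : ι →₀ ℕ) :
    pmon a N = algebraMap L k ((divPart q N).prod fun i n => x i ^ n) * pmon a (modPart q N) := by
  conv_lhs => rw [← nsmul_divPart_add_modPart q N]
  rw [pmon_add, h.pmon_nsmul_eq]

omit [Field L] [Field k] [Algebra L k] in
/-- The integer identity behind iterativity: `C(N,T₂) C(N−T₂,T₁) = C(T₁+T₂,T₁) C(N,T₁+T₂)`. [folklore] -/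
theorem mchoose_mul_mchoose_tsub (N T₁ T₂ : ι →₀ ℕ) :
    mchoose N T₂ * mchoose (N - T₂) T₁ = mchoose (T₁ + T₂) T₁ * mchoose N (T₁ + T₂) := by
  classical
  -- write all four multi-binomials as products over the common finite set `supp T₁ ∪ supp T₂`
  have key : ∀ (A B : ι →₀ ℕ) (s : Finset ι), B.support ⊆ s → mchoose A B = ∏ i ∈ s, (A i).choose (B i) := by
    intro A B s hs
    unfold mchoose
    exact Finset.prod_subset hs fun i _ hi => by rw [Finsupp.notMem_support_iff.mp hi, Nat.choose_zero_right]
  set s := T₁.support ∪ T₂.support with hs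
  have h12 : (T₁ + T₂).support ⊆ s := Finsupp.support_add
  rw [key N T₂ s Finset.subset_union_right, key (N - T₂) T₁ s Finset.subset_union_left,
    key (T₁ + T₂) T₁ s Finset.subset_union_left, key N (T₁ + T₂) s h12, ← Finset.prod_mul_distrib,
    ← Finset.prod_mul_distrib]
  refine Finset.prod_congr rfl fun i _ => ?_
  simp only [Finsupp.coe_tsub, Pi.sub_apply, Finsupp.coe_add, Pi.add_apply]
  -- one coordinate: `C(n,b) C(n-b,a) = C(a+b,a) C(n,a+b)` (from `Nat.choose_mul`)
  have h := Nat.choose_mul (n := N i) (k := T₁ i + T₂ i) (s := T₂ i) (Nat.le_add_left _ _)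
  rw [Nat.add_sub_cancel] at h
  rw [← h, mul_comm, Nat.choose_symm_add]

/-! ### The Hasse–Schmidt operators of the tower -/

/-- **The Hasse–Schmidt operator `D^{(T)}`** of the tower: the `L`-linear map with `a^W ↦ C(W,T) a^{W−T}` on the
box basis (MIZUTANI-PROOF-g59 §1.4 "`D^{(T)}(a^V) := binom(V,T) a^{V−T}`"; Oda's `∂_λ`, p. 1167; EGA IV 16.11.2).
[cite: Oda1983HironakaGroupSchemeII, §1 (p. 1166–1167: the operators ∂_λ with ∂_λ a^μ = (μ choose λ) a^{μ−λ})] -/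
noncomputable def IsPTower.hsD (h : IsPTower L k q x a) (T : ι →₀ ℕ) : k →ₗ[L] k :=
  h.basis.constr L fun W : BoxIdx ι q => (mchoose W.1 T : L) • pmon a (W.1 - T)

/-- `D^{(T)}` on a box monomial. [folklore] -/
theorem IsPTower.hsD_pmon_of_inBox (h : IsPTower L k q x a) (T : ι →₀ ℕ) {W : ι →₀ ℕ} (hW : InBox q W) :
    h.hsD T (pmon a W) = (mchoose W T : L) • pmon a (W - T) := by
  have := Module.Basis.constr_basis h.basis L (fun W : BoxIdx ι q => (mchoose W.1 T : L) • pmon a (W.1 - T))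
    ⟨W, hW⟩
  rw [h.basis_apply] at this
  exact this

variable {p e : ℕ} [hp : Fact p.Prime] [CharP L p]

omit [Field k] [Algebra L k] in
/-- Lucas for multi-binomials: `C(N,T) = C(N mod q, T)` in characteristic `p`, for `T` in the box, `q = p^e`.
[folklore] -/
theorem natCast_mchoose_eq_mchoose_modPart {T : ι →₀ ℕ} (hT : InBox (p ^ e) T) (N : ι →₀ ℕ) :
    (mchoose N T : L) = (mchoose (modPart (p ^ e) N) T : L) := by
  unfold mchoose
  rw [Nat.cast_prod, Nat.cast_prod]
  refine Finset.prod_congr rfl fun i _ => ?_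
  rw [modPart_apply]
  exact natCast_choose_eq_choose_mod_pow L e (hT i) (N i)

/-- **`D^{(T)} a^N = C(N,T) a^{N−T}` for EVERY exponent `N`** (`T` in the box): reduce `N` modulo `q` and use
Lucas. [cite: EGAIV4, Thm. 16.11.2 (16.11.2.1)] -/
theorem IsPTower.hsD_pmon (h : IsPTower L k (p ^ e) x a) {T : ι →₀ ℕ} (hT : InBox (p ^ e) T) (N : ι →₀ ℕ) :
    h.hsD T (pmon a N) = (mchoose N T : L) • pmon a (N - T) := by
  have hq : 0 < p ^ e := pow_pos hp.out.pos e
  rw [h.pmon_eq N, ← Algebra.smul_def, LinearMap.map_smul, h.hsD_pmon_of_inBox T (inBox_modPart hq N),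
    natCast_mchoose_eq_mchoose_modPart hT N]
  by_cases hle : T ≤ modPart (p ^ e) N
  · -- `N − T = q•⌊N/q⌋ + (N mod q − T)`
    have hsub : N - T = (p ^ e) • divPart (p ^ e) N + (modPart (p ^ e) N - T) := by
      ext i
      have h1 := congrArg (fun M : ι →₀ ℕ => M i) (nsmul_divPart_add_modPart (p ^ e) N)
      have h2 : T i ≤ modPart (p ^ e) N i := hle i
      simp only [Finsupp.coe_add, Finsupp.coe_smul, Pi.add_apply, Pi.smul_apply, smul_eq_mul,
        Finsupp.coe_tsub, Pi.sub_apply] at h1 h2 ⊢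
      omega
    rw [hsub, pmon_add, h.pmon_nsmul_eq, ← Algebra.smul_def, smul_smul, smul_smul, mul_comm]
  · rw [mchoose_eq_zero_of_not_le hle, Nat.cast_zero, zero_smul, zero_smul, smul_zero]

/-- **The operators are induced by the Hasse–Schmidt derivatives of the polynomial ring**:
`D^{(T)}(f(a)) = (D^{(T)} f)(a)` for `f ∈ L[X_ι]` and `T` in the box.
[cite: EGAIV4, Thm. 16.11.2 (the D_p of a polynomial algebra)] -/
theorem IsPTower.hsD_aeval (h : IsPTower L k (p ^ e) x a) {T : ι →₀ ℕ} (hT : InBox (p ^ e) T)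
    (f : MvPolynomial ι L) : h.hsD T (aeval a f) = aeval a (hasseDeriv L T f) := by
  classical
  induction f using MvPolynomial.induction_on' with
  | monomial N c =>
    rw [aeval_monomial_eq_smul_pmon, LinearMap.map_smul, h.hsD_pmon hT, hasseDeriv_monomial, map_mul,
      map_natCast, aeval_monomial_eq_smul_pmon, smul_comm, Algebra.smul_def, map_natCast]
    rfl
  | add f g hf hg => rw [map_add, map_add, map_add, map_add, hf, hg]

/-- Every element of `k` is a polynomial in `a` over `L`. [folklore] -/
theorem IsPTower.aeval_surjective (h : IsPTower L k q x a) : Function.Surjective (aeval (R := L) a) := by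
  intro y
  have hy : y ∈ Submodule.span L (Set.range fun W : BoxIdx ι q => pmon a W.1) := by rw [h.span_eq_top]; trivial
  refine Submodule.span_induction ?_ ⟨0, by simp⟩ ?_ ?_ hy
  · rintro _ ⟨W, rfl⟩
    exact ⟨monomial W.1 1, by rw [aeval_monomial_eq_smul_pmon, one_smul]⟩
  · rintro _ _ _ _ ⟨f, rfl⟩ ⟨g, rfl⟩; exact ⟨f + g, map_add _ _ _⟩
  · rintro c _ _ ⟨f, rfl⟩; exact ⟨c • f, by rw [map_smul]⟩

/-- **`D^{(0)} = id`.** [cite: EGAIV4, Thm. 16.11.2 (D_0 = 1)] -/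
theorem IsPTower.hsD_zero_apply (h : IsPTower L k (p ^ e) x a) (y : k) : h.hsD 0 y = y := by
  obtain ⟨f, rfl⟩ := h.aeval_surjective y
  rw [h.hsD_aeval (fun i => pow_pos hp.out.pos e), hasseDeriv_zero_apply]

/-- **Leibniz rule** `D^{(T)}(yz) = Σ_{T₁+T₂=T} D^{(T₁)}y · D^{(T₂)}z` (`T` in the box).
[cite: EGAIV4, Thm. 16.11.2 (16.11.2.2)] -/
theorem IsPTower.hsD_mul [DecidableEq ι] (h : IsPTower L k (p ^ e) x a) {T : ι →₀ ℕ} (hT : InBox (p ^ e) T)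
    (y z : k) : h.hsD T (y * z) = ∑ w ∈ Finset.antidiagonal T, h.hsD w.1 y * h.hsD w.2 z := by
  obtain ⟨f, rfl⟩ := h.aeval_surjective y
  obtain ⟨g, rfl⟩ := h.aeval_surjective z
  rw [← map_mul, h.hsD_aeval hT, hasseDeriv_mul, map_sum]
  refine Finset.sum_congr rfl fun w hw => ?_
  have hw' : w.1 + w.2 = T := Finset.mem_antidiagonal.mp hw
  have h1 : InBox (p ^ e) w.1 := fun i => lt_of_le_of_lt (by rw [← hw']; exact Nat.le_add_right _ _) (hT i)
  have h2 : InBox (p ^ e) w.2 := fun i => lt_of_le_of_lt (by rw [← hw']; exact Nat.le_add_left _ _) (hT i)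
  rw [map_mul, h.hsD_aeval h1, h.hsD_aeval h2]

/-- **Iterativity** `D^{(T₁)}(D^{(T₂)} y) = C(T₁+T₂, T₁) D^{(T₁+T₂)} y` (`T₁ + T₂` in the box).
[cite: EGAIV4, Thm. 16.11.2 (the D_p form an iterative higher derivation)] -/
theorem IsPTower.hsD_hsD (h : IsPTower L k (p ^ e) x a) {T₁ T₂ : ι →₀ ℕ} (hT : InBox (p ^ e) (T₁ + T₂))
    (y : k) : h.hsD T₁ (h.hsD T₂ y) = (mchoose (T₁ + T₂) T₁ : L) • h.hsD (T₁ + T₂) y := by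
  classical
  have h1 : InBox (p ^ e) T₁ := fun i => lt_of_le_of_lt (Nat.le_add_right _ _) (hT i)
  have h2 : InBox (p ^ e) T₂ := fun i => lt_of_le_of_lt (Nat.le_add_left _ _) (hT i)
  obtain ⟨f, rfl⟩ := h.aeval_surjective y
  induction f using MvPolynomial.induction_on' with
  | monomial N c =>
    simp only [aeval_monomial_eq_smul_pmon, LinearMap.map_smul, h.hsD_pmon h2, h.hsD_pmon h1, h.hsD_pmon hT,
      smul_smul]
    rw [tsub_tsub, add_comm T₂ T₁]
    congr 1
    have key := congrArg (fun n : ℕ => (n : L)) (mchoose_mul_mchoose_tsub N T₁ T₂)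
    push_cast at key
    rw [mul_assoc, key]; ring
  | add f g hf hg => simp only [map_add, hf, hg, smul_add]

end PTower

end Summit.ResolutionOfSingularities.KangarooAtlas.Mizutani
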